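import Literature.AlgebraicGeometry.HodgeTheory.PencilStepBelowMiddleOfVerdier
import Literature.AlgebraicGeometry.HodgeTheory.SpreadSupportsOfSmoothFamily
import HarnessLib

/-!
# Route AnchorTransport — `VariationalHodge` (stmt-HodgeConjecture-1076), line `polar-patch-broken-cycles`: the pencil SWEEP (helper for stub `stub_reductionToFourfoldsTwo`)

The tree's `mem_algebraicClasses_of_two_mul_le_of_spread_supports` (`PencilStepBelowMiddleOfVerdier`)
proves the pencil step below the middle from the Hodge conjecture on ALL `m`-folds (`hHC`). Its proof
uses `hHC` at exactly two places: (a) algebraicity of `ι_t^* σ^* c` on the smooth MEMBERS of the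
chosen good pencil, (b) the statement in codimension `p - 1` on `X` itself. This file records the
same proof with `hHC` replaced by these two hypotheses (`halg`, `hIH`) and the pencil GIVEN — the
"sweep back to `X_s`" of Thomas's hyperplane descent (arXiv:math/0212216 §2, proof of Prop. 2), on
the real carrier `complexBetti` with the real Gysin maps `complexGysin`. For `p = 2`, `hIH` is
Lefschetz `(1,1)` on `X` (`lefschetzOneOne_rational_holds`).

-- adapted from Literature/AlgebraicGeometry/HodgeTheory/PencilStepBelowMiddleOfVerdier.lean
-- (`mem_algebraicClasses_of_two_mul_le_of_spread_supports`, steps (2)–(5) verbatim)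
-/

noncomputable section

-- every declaration of this problem lives in `Summit.HodgeConjecture.HodgeConjecture.…`
set_option linter.dupNamespace false

open scoped Manifold ContDiff
open CategoryTheory CategoryTheory.Limits AlgebraicGeometry MonoidalCategory CartesianMonoidalCategory
open Literature.AlgebraicTopology.SingularHomology
open Literature.AlgebraicGeometry.Motives Literature.AlgebraicGeometry.HodgeTheory

namespace Summit.HodgeConjecture.HodgeConjecture.Theorems

/-- **Sweep from the good members of a pencil back to `X`** (Thomas 2005 §2, proof of Prop. 2, case
`k < d/2`; de Cataldo–Migliorini 2009 §4): `X` smooth projective of dimension `m + 1`, `(ι, a)` a pencil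
with smooth projective total space and smooth projective members off a proper closed `T ⊆ ℙ¹`,
`2 (q + 1) ≤ m`; if every rational `(q,q)`-class of `X` is algebraic and the class `c ∈ H^{2q+2}(X)`
(no rationality or Hodge-type hypothesis needed) is algebraic on every good member, then `c` is
algebraic on `X`. [folklore] -/
theorem mem_algebraicClasses_of_pencil_members
    {m N : ℕ} {X : SchemeOver ℂ} (hX : IsSmoothProjective (m + 1) X)
    (ι : X ⟶ projectiveSpace N ℂ) [IsClosedImmersion ι.left]
    {a : Fin (1 + 1) → Fin (N + 1) → ℂ} (ha : a ≠ 0)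
    (hXt : IsSmoothProjective (m + 1) (LinearSectionNet.total ι a))
    {T : Set (projectiveSpace 1 ℂ).left} (hT : IsClosed T) (hTne : T ≠ Set.univ)
    (hfib : ∀ s : ComplexPoints (projectiveSpace 1 ℂ), s.pt ∉ T →
      IsSmoothProjective m (fiberOver (LinearSectionNet.proj ι a) s))
    {q : ℕ} (hpm : 2 * (q + 1) ≤ m)
    (hIH : ∀ c' : complexBetti X (2 * q), IsRationalClass c' → IsOfHodgeType (m + 1) X (2 * q) q q c' →
      c' ∈ algebraicClasses X q)
    (c : complexBetti X (2 * (q + 1)))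
    (halg : ∀ s : ComplexPoints (projectiveSpace 1 ℂ), s.pt ∉ T →
      complexBetti.map (fiberι (LinearSectionNet.proj ι a) s) (2 * (q + 1))
        (complexBetti.map (LinearSectionNet.blowDown ι a) (2 * (q + 1)) c) ∈
        algebraicClasses (fiberOver (LinearSectionNet.proj ι a) s) (q + 1)) :
    c ∈ algebraicClasses X (q + 1) := by
  have hI : spread_supports_over_projectiveLine := spread_supports_over_projectiveLine_holds
  -- players
  have hP : IsSmoothProjective 1 (projectiveSpace 1 ℂ) := isSmoothProjective_projectiveSpace' 1
  haveI : IrreducibleSpace (projectiveSpace 1 ℂ).left := hP.irreducibleSpace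
  let μ : OrientationFamily := fun _ _ hZ ↦ (ComplexPoints.isOrientableOver ℂ hZ).some
  have hμ : μ.HasPoincareDuality := OrientationFamily.hasPoincareDuality μ
  have hS := gysinMap_restrictCompl_eq_zero_of_field.{0, 0} ℂ
  haveI hsurj : Surjective (LinearSectionNet.proj ι a).left :=
    surjective_proj_left_of_goodPencil ι a hXt hT hTne hfib
  have hV : IsSmoothProjective (m + 1 + 1) (X ⊗ projectiveSpace 1 ℂ) := IsSmoothProjective.tensor_holds hX hP
  -- `c̃ = σ^* c`
  set ct : complexBetti (LinearSectionNet.total ι a) (2 * (q + 1)) :=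
    complexBetti.map (LinearSectionNet.blowDown ι a) (2 * (q + 1)) c with hctdef
  -- (2) spreading of the fibrewise supports (leaf (I))
  obtain ⟨𝒵, h𝒵, hc𝒵, S', hS', hTS', hS'ne, hdies⟩ :=
    hI hXt (show 1 ≤ q + 1 by omega)
      (show q + 1 < m + 1 by omega) (LinearSectionNet.proj ι a) T hT hTne
      (fun s hs ↦ by rw [Nat.add_sub_cancel]; exact hfib s hs) ct halg
  -- (3) vertical support lines on `X̃`, for a generator `η` of `H²(ℙ¹)`
  obtain ⟨η, hη⟩ : ∃ η : complexBetti (projectiveSpace 1 ℂ) 2, η ≠ 0 := by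
    have h1 : Module.finrank ℂ (complexBetti (projectiveSpace 1 ℂ) 2) = 1 :=
      finrank_complexBetti_projectiveSpace_two_mul_eq_one 1 (p := 1) le_rfl
    haveI := Module.nontrivial_of_finrank_eq_succ h1
    exact exists_ne 0
  obtain ⟨e, he⟩ : ∃ e, q + 1 + e + 1 = m + 1 := ⟨m - (q + 1), by omega⟩
  have hXt' : IsSmoothProjective (q + 1 + e + 1) (LinearSectionNet.total ι a) := by rw [he]; exact hXt
  obtain ⟨S₀, hS₀, hS₀ne, s, hs, hlines⟩ :=
    exists_verticalSupportLines hXt' hP (LinearSectionNet.proj ι a) h𝒵 hc𝒵 hη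
  -- a good member: `t ∉ S' ∪ S₀`
  obtain ⟨t, ht⟩ := exists_complexPoint_pt_not_mem (hS'.union hS₀)
    (union_ne_univ_of_isClosed hS' hS'ne hS₀ hS₀ne)
  have htS' : t.pt ∉ S' := fun h ↦ ht (Or.inl h)
  have htS₀ : t.pt ∉ S₀ := fun h ↦ ht (Or.inr h)
  have hY : IsSmoothProjective m (fiberOver (LinearSectionNet.proj ι a) t) := hfib t fun h ↦ htS' (hTS' h)
  -- notation
  set φ := LinearSectionNet.proj ι a with hφdef
  set ιt := fiberι φ t with hιtdef
  set ut := fiberι φ t ≫ LinearSectionNet.blowDown ι a with hutdef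
  haveI : IsClosedImmersion ιt.left := isClosedImmersion_fiberι_proj_left ι a t
  have hab : 2 * (q + 1) + 2 * (m + 1) = 2 * (q + 1 + 1) + 2 * m := by ring
  have hab₀ : 0 + 2 * (m + 1) = 2 + 2 * m := by ring
  have h2 : 2 + 2 * (q + 1) = 2 * (q + 1 + 1) := by ring
  have h2' : 2 * (q + 1) + 2 = 2 * (q + 1 + 1) := by ring
  -- (3a) `(ι_t)_* (ι_t^* c̃)` dies off `𝒵 ∩ π⁻¹(t)`
  set xt : complexBetti (fiberOver φ t) (2 * (q + 1)) := complexBetti.map ιt (2 * (q + 1)) ct with hxtdef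
  have hpre : ιt.left.base ⁻¹' (𝒵 ∩ φ.left.base ⁻¹' {t.pt}) = ιt.left.base ⁻¹' 𝒵 := by
    ext z
    simp only [Set.mem_preimage, Set.mem_inter_iff, Set.mem_singleton_iff]
    exact ⟨fun h ↦ h.1, fun h ↦ ⟨h, apply_fiberι_base_eq_pt φ t z⟩⟩
  have hgdies : complexBetti.restrictCompl (LinearSectionNet.total ι a) (𝒵 ∩ φ.left.base ⁻¹' {t.pt})
      (2 * (q + 1 + 1)) (complexGysin μ hY hXt ιt hab xt) = 0 := by
    refine complexGysin_restrictCompl_eq_zero hS μ hμ hY hXt ιt hab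
      (h𝒵.inter (t.isClosed_pt.preimage φ.left.continuous)) xt ?_
    rw [hpre]
    exact hdies t htS'
  obtain ⟨at_, hat_, hF2⟩ := hlines t htS₀ _ hgdies
  -- (3b) the divisor line of the fibre: `(ι_t)_* 1 = κ • π^* η`, `κ ≠ 0`
  obtain ⟨κ, hκ⟩ := exists_complexGysin_fiberι_one_eq_smul_map μ hXt hP φ t hY hη
  have hκ0 : κ ≠ 0 := by
    rintro rfl
    rw [zero_smul] at hκ
    haveI := connectedSpace_complexPoints hY
    obtain ⟨P⟩ : Nonempty (ComplexPoints (fiberOver φ t)) := inferInstance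
    exact complexGysin_one_ne_zero_of_stalkMap_surjective μ hXt hY ιt P (ιt.left.stalkMap_surjective P.pt)
      (e := 1) (by omega) hκ
  -- (3c) projection formula for `ι_t`: `(ι_t)_* (ι_t^* b) = b ∪ (ι_t)_* 1 = κ • (π^* η ∪ b)`
  have hprojι : ∀ b : complexBetti (LinearSectionNet.total ι a) (2 * (q + 1)),
      complexGysin μ hY hXt ιt hab (complexBetti.map ιt (2 * (q + 1)) b) =
        κ • cupProduct h2 (complexBetti.map φ 2 η) b := fun b ↦ by
    have h3 := complexGysin_cup hμ hY hXt ιt (Nat.add_zero (2 * (q + 1))) hab hab₀ h2' b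
      (singularCohomology.one ℂ (ComplexPoints (fiberOver φ t)))
    rw [cupProduct_one] at h3
    rw [h3, hκ, map_smul, cupProduct_gradedComm_holds ℂ _ h2' h2 b, Even.neg_one_pow ⟨2 * (q + 1), by ring⟩,
      one_smul]
  -- hence `π^* η ∪ (κ • c̃ − a_t) = 0`
  have hkey : cupProduct h2 (complexBetti.map φ 2 η) (κ • ct - at_) = 0 := by
    rw [map_sub, map_smul, ← hprojι ct, ← hxtdef, hF2, sub_self]
  -- (4) descent of the generators: `ι_t^* a = u_t^* α` with `α` algebraic, for all `a ∈ span s`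
  have hgen : ∀ a' ∈ Submodule.span ℂ s, ∃ α ∈ algebraicClasses X (q + 1),
      complexBetti.map ιt (2 * (q + 1)) a' = complexBetti.map ut (2 * (q + 1)) α := by
    intro a' ha'
    induction ha' using Submodule.span_induction with
    | mem r hr =>
      obtain ⟨hrN, hrQ⟩ := hs r hr
      have hrH : IsOfHodgeType (m + 1) (LinearSectionNet.total ι a) (2 * (q + 1)) (q + 1) (q + 1) r :=
        isOfHodgeType_of_mem_algebraicClasses_of_isSmoothProjective hXt (q + 1) hrN
      -- weak Lefschetz for `emb : X̃ ⟶ X × ℙ¹`: `r = emb^* ζ`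
      have hAF1 := HypersurfaceSectionComplement.isZero_singularHomology_compl_range_hypersurfaceSectionι
        (R := ℂ) (M₀ := ℂ) hV
        (⟨_, Incidence.toSegre ι (𝟙 (projectiveSpace 1 ℂ)), isClosedImmersion_toSegre_id_left ι⟩ :
          ProjectiveEmbedding (X ⊗ projectiveSpace 1 ℂ))
        le_rfl (LinearSectionNet.incidenceForm a ((0 : Fin 2), (1 : Fin 2)))
        (LinearSectionNet.isHomogeneous_incidenceForm a _) (j := 2 * (m + 1 + 1) - 1 - 2 * (q + 1)) (by omega)
      rw [← range_map_emb_eq_range_map_hypersurfaceSectionι_pencil a ι] at hAF1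
      obtain ⟨ζ, hζ⟩ := surjective_complexBettiMap_of_isZero_singularHomology_compl_range hV hXt
        (LinearSectionNet.emb ι a) (j := 2 * (m + 1 + 1) - 1 - 2 * (q + 1)) (by omega) hAF1 r
      -- `α_r = s_t^* ζ`; `ι_t^* r = u_t^* α_r`
      have hres : complexBetti.map ιt (2 * (q + 1)) r =
          complexBetti.map ut (2 * (q + 1)) (complexBetti.map (sliceAt X t) (2 * (q + 1)) ζ) := by
        rw [← hζ, hιtdef, hutdef, ← CategoryTheory.comp_apply, ← complexBetti.map_comp,
          fiberι_emb_eq_sliceAt, ← CategoryTheory.comp_apply, ← complexBetti.map_comp]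
      refine ⟨_, ?_, hres⟩
      exact mem_algebraicClasses_of_pencil_spread hX ι ha hXt hpm hIH _ hrN hrQ hrH t hY hres
    | zero => exact ⟨0, Submodule.zero_mem _, by rw [map_zero, map_zero]⟩
    | add x y _ _ hx hy =>
      obtain ⟨α, hα, hxα⟩ := hx
      obtain ⟨β, hβ, hyβ⟩ := hy
      exact ⟨α + β, Submodule.add_mem _ hα hβ, by rw [map_add, map_add, hxα, hyβ]⟩
    | smul w x _ hx =>
      obtain ⟨α, hα, hxα⟩ := hx
      exact ⟨w • α, Submodule.smul_mem _ w hα, by rw [map_smul, map_smul, hxα]⟩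
  obtain ⟨α, hα, hια⟩ := hgen at_ hat_
  -- (5) hard Lefschetz: `z = κ • c − α` has `z ∪ (u_t)_* 1 = 0`
  set z : complexBetti X (2 * (q + 1)) := κ • c - α with hzdef
  have huz : complexBetti.map ut (2 * (q + 1)) z = complexBetti.map ιt (2 * (q + 1)) (κ • ct - at_) := by
    rw [hzdef, map_sub, map_smul, map_sub, map_smul, hια, hctdef, hutdef, complexBetti.map_comp,
      CategoryTheory.comp_apply]
  have hιy : complexGysin μ hY hXt ιt hab (complexBetti.map ιt (2 * (q + 1)) (κ • ct - at_)) = 0 := by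
    rw [hprojι, hkey, smul_zero]
  have huy : complexGysin μ hY hX ut hab (complexBetti.map ut (2 * (q + 1)) z) = 0 := by
    rw [huz, hutdef, complexGysin_comp hμ hY hXt hX (fiberι φ t) (LinearSectionNet.blowDown ι a) hab
      (show 2 * (q + 1 + 1) + 2 * (m + 1) = 2 * (q + 1 + 1) + 2 * (m + 1) from rfl), LinearMap.comp_apply,
      ← hιtdef, hιy, map_zero]
  have hcup : cupProduct h2' z (complexGysin μ hY hX ut hab₀
      (singularCohomology.one ℂ (ComplexPoints (fiberOver φ t)))) = 0 := by
    have h3 := complexGysin_cup hμ hY hX ut (Nat.add_zero (2 * (q + 1))) hab hab₀ h2' z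
      (singularCohomology.one ℂ (ComplexPoints (fiberOver φ t)))
    rw [cupProduct_one] at h3
    rw [← h3, huy]
  have hz0 : z = 0 :=
    eq_zero_of_cupProduct_complexGysin_one_eq_zero hX ι a t hY μ hpm hcup
  -- `c = κ⁻¹ • α`
  have hcα : c = κ⁻¹ • α := by
    have h1 : κ • c = α := sub_eq_zero.1 (by rw [← hzdef, hz0])
    rw [← h1, smul_smul, inv_mul_cancel₀ hκ0, one_smul]
  rw [hcα]
  exact Submodule.smul_mem _ _ hα

/-- **Registered stub `stub_pencilSweep` of the line `polar-patch-broken-cycles`** (skeleton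
`Cruxes/VariationalHodge/Lines/polar_patch_broken_cycles.lean`, lead's split of S4, cycle 1): the pencil
sweep `mem_algebraicClasses_of_pencil_members` in the registry's binder shape. [folklore] -/
theorem stub_pencilSweep :
    ∀ {m N : ℕ} {X : SchemeOver ℂ}, IsSmoothProjective (m + 1) X →
      ∀ (ι : X ⟶ projectiveSpace N ℂ) [IsClosedImmersion ι.left]
      {a : Fin (1 + 1) → Fin (N + 1) → ℂ}, a ≠ 0 →
      IsSmoothProjective (m + 1) (LinearSectionNet.total ι a) →
      ∀ {T : Set (projectiveSpace 1 ℂ).left}, IsClosed T → T ≠ Set.univ →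
      (∀ s : ComplexPoints (projectiveSpace 1 ℂ), s.pt ∉ T →
        IsSmoothProjective m (fiberOver (LinearSectionNet.proj ι a) s)) →
      ∀ {q : ℕ}, 2 * (q + 1) ≤ m →
      (∀ c' : complexBetti X (2 * q), IsRationalClass c' → IsOfHodgeType (m + 1) X (2 * q) q q c' →
        c' ∈ algebraicClasses X q) →
      ∀ (c : complexBetti X (2 * (q + 1))),
      (∀ s : ComplexPoints (projectiveSpace 1 ℂ), s.pt ∉ T →
        complexBetti.map (fiberι (LinearSectionNet.proj ι a) s) (2 * (q + 1))
          (complexBetti.map (LinearSectionNet.blowDown ι a) (2 * (q + 1)) c) ∈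
          algebraicClasses (fiberOver (LinearSectionNet.proj ι a) s) (q + 1)) →
      c ∈ algebraicClasses X (q + 1) :=
  fun hX ι _ _ ha hXt _ hT hTne hfib _ hpm hIH c halg =>
    mem_algebraicClasses_of_pencil_members hX ι ha hXt hT hTne hfib hpm hIH c halg

end Summit.HodgeConjecture.HodgeConjecture.Theorems

end
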